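import Mathlib
import Summits.AnomalousDissipation.AnomalousDissipation.Theorems.SoloBlindDiscCover

/-!
# Solo-blind kernel #276 — cover CERTIFICATE for SHEARED (moving) discs, uniformly in the dilation λ

(Complements the analytic inflated-radius inequality `SoloBlind.ShearedCover.sheared_cover` of the
earlier kernel `SoloBlindShearedCover.lean`, which covers column rectangles by ONE sheared disc of
enlarged radius; here the ACTUAL box lists with their production radii are certified.)
Kernel #272 certifies that fixed discs cover a rectangle.  The SHEARED boxes of ENGINE L
(`JOB_SHEAR=1`, `KCEN=sym`; ENGINE-L-SPEC §10, §15(p)) are discs whose centre moves with the coupling: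
at dilation `λ = g_c²/g²` the box is `{(x,y) : (x − λ c_x)² + (y − λ c_y)² ≤ r²}`; straight boxes are the
case "not moving".  A g-piece needs the cover for EVERY `λ ∈ [λ_lo, λ_hi]`.  Certificate (the
kernel-checkable form of `tools/cover_check.py`): a λ-grid `λ_k = λ₀ + kΔ`, `k < N`; at each grid value
the cell/vertex test of #272 is run against the moving discs placed at `λ_k` and SHRUNK by their motion
bound `mΔ` (`m` a rational with `m ≥ 0`, `m² ≥ c_x² + c_y²`, part of the certificate); then for
`λ ∈ [λ_k, λ_k + Δ]` the triangle inequality puts the cell inside the un-shrunk disc at `λ`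
(`cell_subset_mdisc`).  `rect_covered_moving` / `bound_on_rect_moving`: certificate ⇒ for every
`λ ∈ [λ₀, λ₀ + NΔ]` every point of the rectangle lies in some disc at `λ` ⇒ per-box bounds transfer to
the rectangle uniformly in `λ`.
-/

namespace Summit.AnomalousDissipation.SoloBlind.MovingDiscCover

open Complex
open Summit.AnomalousDissipation.SoloBlind.DiscCover

/-- A possibly-moving closed disc with rational data: centre direction `(cx, cy)`, radius `r`, a motion
bound `m` (intended `m ≥ |(cx,cy)|`), and the flag `moving` (sheared) / not (straight). -/
structure MDisc where
  /-- centre, real part (at λ = 1) -/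
  cx : ℚ
  /-- centre, imaginary part (at λ = 1) -/
  cy : ℚ
  /-- radius -/
  r : ℚ
  /-- motion bound, `m² ≥ cx² + cy²`, `m ≥ 0` (checked by the certificate) -/
  m : ℚ
  /-- sheared (centre scales with λ) or straight (fixed) -/
  moving : Bool

/-- The scale applied to the centre at dilation `λ`. -/
def MDisc.scale (D : MDisc) (lam : ℝ) : ℝ := if D.moving then lam else 1

/-- The disc at dilation `λ`, as a subset of `ℝ × ℝ`. -/
def MDisc.carrierAt (D : MDisc) (lam : ℝ) : Set (ℝ × ℝ) :=
  {p | (p.1 - D.scale lam * D.cx) ^ 2 + (p.2 - D.scale lam * D.cy) ^ 2 ≤ (D.r : ℝ) ^ 2}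

/-- Membership, unfolded. -/
theorem MDisc.mem_carrierAt {D : MDisc} {lam x y : ℝ} :
    (x, y) ∈ D.carrierAt lam ↔
      (x - D.scale lam * D.cx) ^ 2 + (y - D.scale lam * D.cy) ^ 2 ≤ (D.r : ℝ) ^ 2 := Iff.rfl

/-- The shrink applied at a grid value: `mΔ` for moving discs, `0` for fixed ones. -/
def MDisc.shrink (D : MDisc) (Δ : ℚ) : ℚ := if D.moving then D.m * Δ else 0

/-- The rational scale at a rational grid value. -/
def MDisc.scaleQ (D : MDisc) (lamk : ℚ) : ℚ := if D.moving then lamk else 1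

/-- Rational vertex test against the disc placed at grid value `λ_k` and shrunk by `shrink Δ`. -/
def vertInM (D : MDisc) (lamk Δ x y : ℚ) : Bool :=
  decide ((x - D.scaleQ lamk * D.cx) ^ 2 + (y - D.scaleQ lamk * D.cy) ^ 2 ≤ (D.r - D.shrink Δ) ^ 2)

/-- Sanity of the disc data: motion bound valid, shrunk radius non-negative. -/
def discOK (D : MDisc) (Δ : ℚ) : Bool :=
  decide (0 ≤ D.m) && decide (D.cx ^ 2 + D.cy ^ 2 ≤ D.m ^ 2) && decide (0 ≤ D.r - D.shrink Δ)

/-- Cell-in-moving-disc test at grid value `λ_k` with step `Δ`. -/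
def cellInMDisc (c : Cell) (D : MDisc) (lamk Δ : ℚ) : Bool :=
  discOK D Δ && vertInM D lamk Δ c.x0 c.y0 && vertInM D lamk Δ c.x0 c.y1 &&
    vertInM D lamk Δ c.x1 c.y0 && vertInM D lamk Δ c.x1 c.y1

/-- One grid step: every cell in some disc. -/
def coverStep (cells : List Cell) (discs : List MDisc) (lamk Δ : ℚ) : Bool :=
  cells.all fun c => discs.any fun D => cellInMDisc c D lamk Δ

/-- The whole certificate: all grid values `λ₀ + kΔ`, `k < N`. -/
def coverAll (cells : List Cell) (discs : List MDisc) (lam0 Δ : ℚ) (N : ℕ) : Bool :=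
  (List.range N).all fun k => coverStep cells discs (lam0 + (k : ℚ) * Δ) Δ

/-- `‖(a : ℂ) + b I‖² = a² + b²`. -/
theorem norm_sq_mk (a b : ℝ) : ‖(a : ℂ) + (b : ℂ) * I‖ ^ 2 = a ^ 2 + b ^ 2 := by
  rw [Complex.sq_norm, Complex.normSq_add_mul_I]

/-- From a bound on the sum of squares to a bound on the Euclidean norm. -/
theorem norm_mk_le {a b ρ : ℝ} (hρ : 0 ≤ ρ) (h : a ^ 2 + b ^ 2 ≤ ρ ^ 2) :
    ‖(a : ℂ) + (b : ℂ) * I‖ ≤ ρ := by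
  have h2 : ‖(a : ℂ) + (b : ℂ) * I‖ ^ 2 ≤ ρ ^ 2 := by rw [norm_sq_mk]; exact h
  exact (pow_le_pow_iff_left₀ (norm_nonneg _) hρ two_ne_zero).1 h2

/-- **The moving-disc step** (triangle inequality): a point within `r − mΔ'` of the centre placed at
scale `s_k`, with `|s − s_k| ≤ Δ'`, `m ≥ 0`, `m² ≥ cx² + cy²`, `0 ≤ r − mΔ'`, lies within `r` of the
centre placed at scale `s`. -/
theorem moved_point {x y cx cy r m sk s Δ' : ℝ} (hm : 0 ≤ m) (hm2 : cx ^ 2 + cy ^ 2 ≤ m ^ 2)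
    (hr : 0 ≤ r - m * Δ') (hs : |s - sk| ≤ Δ')
    (hin : (x - sk * cx) ^ 2 + (y - sk * cy) ^ 2 ≤ (r - m * Δ') ^ 2) :
    (x - s * cx) ^ 2 + (y - s * cy) ^ 2 ≤ r ^ 2 := by
  have hΔ' : 0 ≤ Δ' := le_trans (abs_nonneg _) hs
  -- the two vectors
  have h1 : ‖((x - sk * cx : ℝ) : ℂ) + ((y - sk * cy : ℝ) : ℂ) * I‖ ≤ r - m * Δ' := norm_mk_le hr hin
  have h2 : ‖(((sk - s) * cx : ℝ) : ℂ) + (((sk - s) * cy : ℝ) : ℂ) * I‖ ≤ m * Δ' := by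
    refine norm_mk_le (by positivity) ?_
    have hss : (sk - s) ^ 2 ≤ Δ' ^ 2 := by
      have : |sk - s| ≤ Δ' := by rw [abs_sub_comm]; exact hs
      calc (sk - s) ^ 2 = |sk - s| ^ 2 := (sq_abs _).symm
        _ ≤ Δ' ^ 2 := pow_le_pow_left₀ (abs_nonneg _) this 2
    calc ((sk - s) * cx) ^ 2 + ((sk - s) * cy) ^ 2 = (sk - s) ^ 2 * (cx ^ 2 + cy ^ 2) := by ring
      _ ≤ Δ' ^ 2 * m ^ 2 := mul_le_mul hss hm2 (by positivity) (by positivity)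
      _ = (m * Δ') ^ 2 := by ring
  have hsum : ((x - sk * cx : ℝ) : ℂ) + ((y - sk * cy : ℝ) : ℂ) * I
      + ((((sk - s) * cx : ℝ) : ℂ) + (((sk - s) * cy : ℝ) : ℂ) * I)
      = ((x - s * cx : ℝ) : ℂ) + ((y - s * cy : ℝ) : ℂ) * I := by
    push_cast; ring
  have h3 : ‖((x - s * cx : ℝ) : ℂ) + ((y - s * cy : ℝ) : ℂ) * I‖ ≤ r := by
    rw [← hsum]
    calc _ ≤ ‖((x - sk * cx : ℝ) : ℂ) + ((y - sk * cy : ℝ) : ℂ) * I‖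
          + ‖(((sk - s) * cx : ℝ) : ℂ) + (((sk - s) * cy : ℝ) : ℂ) * I‖ := norm_add_le _ _
      _ ≤ (r - m * Δ') + m * Δ' := add_le_add h1 h2
      _ = r := by ring
  have hr0 : 0 ≤ r := by nlinarith
  have h4 := pow_le_pow_left₀ (norm_nonneg _) h3 2
  rwa [norm_sq_mk] at h4

/-- Soundness of the vertex test at a grid value (real form). -/
theorem vertInM_sound {D : MDisc} {lamk Δ x y : ℚ} (h : vertInM D lamk Δ x y = true) :
    ((x : ℝ) - (D.scaleQ lamk : ℝ) * D.cx) ^ 2 + ((y : ℝ) - (D.scaleQ lamk : ℝ) * D.cy) ^ 2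
      ≤ ((D.r : ℝ) - (D.shrink Δ : ℝ)) ^ 2 := by
  have h' := of_decide_eq_true h
  exact_mod_cast h'

/-- **Cell ⊆ moving disc for all `λ` in the grid step**: if the cell's four vertices pass the shrunk
test at `λ_k` then for every `λ` with `|λ − λ_k| ≤ Δ` the cell lies in the disc at `λ`. -/
theorem cell_subset_mdisc {c : Cell} {D : MDisc} {lamk Δ : ℚ} (h : cellInMDisc c D lamk Δ = true)
    {lam : ℝ} (hlam : |lam - lamk| ≤ Δ) {x y : ℝ} (hxy : (x, y) ∈ c.carrier) :
    (x, y) ∈ D.carrierAt lam := by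
  simp only [cellInMDisc, discOK, Bool.and_eq_true, decide_eq_true_eq] at h
  obtain ⟨⟨⟨⟨⟨⟨hm, hm2⟩, hr⟩, h00⟩, h01⟩, h10⟩, h11⟩ := h
  obtain ⟨hx0, hx1, hy0, hy1⟩ := Cell.mem_carrier.1 hxy
  have e00 := vertInM_sound h00
  have e01 := vertInM_sound h01
  have e10 := vertInM_sound h10
  have e11 := vertInM_sound h11
  -- the point is within the shrunk radius of the centre at scale s_k (convexity, as in #272)
  set sk : ℝ := (D.scaleQ lamk : ℝ) with hsk
  set ρ : ℝ := (D.r : ℝ) - (D.shrink Δ : ℝ) with hρ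
  have hxm := sq_sub_le_max (c := sk * D.cx) hx0 hx1
  have hym := sq_sub_le_max (c := sk * D.cy) hy0 hy1
  have hin : (x - sk * D.cx) ^ 2 + (y - sk * D.cy) ^ 2 ≤ ρ ^ 2 := by
    rcases le_max_iff.1 hxm with hx | hx <;> rcases le_max_iff.1 hym with hy | hy <;> linarith
  have hmR : (0 : ℝ) ≤ D.m := by exact_mod_cast hm
  have hm2R : (D.cx : ℝ) ^ 2 + (D.cy : ℝ) ^ 2 ≤ (D.m : ℝ) ^ 2 := by exact_mod_cast hm2
  have hrR : (0 : ℝ) ≤ (D.r : ℝ) - (D.shrink Δ : ℝ) := by exact_mod_cast hr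
  rw [MDisc.mem_carrierAt]
  -- case on moving
  by_cases hmv : D.moving = true
  · -- moving: scale = λ, scaleQ = λ_k, shrink = mΔ
    have hscale : D.scale lam = lam := by simp [MDisc.scale, hmv]
    have hskv : sk = (lamk : ℝ) := by simp [hsk, MDisc.scaleQ, hmv]
    have hshr : (D.shrink Δ : ℝ) = (D.m : ℝ) * (Δ : ℝ) := by simp [MDisc.shrink, hmv]
    rw [hscale]
    rw [hskv] at hin
    rw [hρ, hshr] at hin
    rw [hshr] at hrR
    exact moved_point hmR hm2R hrR hlam hin
  · -- fixed: scale = 1 = scaleQ, shrink = 0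
    have hmv' : D.moving = false := by simpa using hmv
    have hscale : D.scale lam = 1 := by simp [MDisc.scale, hmv']
    have hskv : sk = 1 := by simp [hsk, MDisc.scaleQ, hmv']
    have hshr : (D.shrink Δ : ℝ) = 0 := by simp [MDisc.shrink, hmv']
    rw [hscale]
    rw [hskv] at hin
    rw [hρ, hshr, sub_zero] at hin
    simpa using hin

/-- Soundness of one grid step. -/
theorem coverStep_sound {cells : List Cell} {discs : List MDisc} {lamk Δ : ℚ}
    (h : coverStep cells discs lamk Δ = true) {lam : ℝ} (hlam : |lam - lamk| ≤ Δ)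
    {c : Cell} (hc : c ∈ cells) {x y : ℝ} (hxy : (x, y) ∈ c.carrier) :
    ∃ D ∈ discs, (x, y) ∈ D.carrierAt lam := by
  simp only [coverStep, List.all_eq_true, List.any_eq_true] at h
  obtain ⟨D, hD, hcD⟩ := h c hc
  exact ⟨D, hD, cell_subset_mdisc hcD hlam hxy⟩

/-- **Certificate ⇒ cover, uniformly in λ.**  If `coverAll` passes on the grid cells of the rectangle
`[x₀, x₀ + nₓhₓ] × [y₀, y₀ + n_yh_y]` for the λ-grid `λ₀ + kΔ`, `k < N` (`Δ ≥ 0`), then for every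
`λ ∈ [λ₀, λ₀ + NΔ]` every point of the rectangle lies in some disc at `λ`. -/
theorem rect_covered_moving {x₀ y₀ hx hy lam0 Δ : ℚ} {nx ny N : ℕ} {discs : List MDisc}
    (hcert : coverAll (gridCells x₀ y₀ hx hy nx ny) discs lam0 Δ N = true)
    (hnx : 0 < nx) (hny : 0 < ny) (hN : 0 < N) (hΔ : 0 ≤ Δ)
    {lam : ℝ} (hl0 : (lam0 : ℝ) ≤ lam) (hl1 : lam ≤ lam0 + N * Δ)
    {x y : ℝ} (hx0 : (x₀ : ℝ) ≤ x) (hx1 : x ≤ x₀ + nx * hx)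
    (hy0 : (y₀ : ℝ) ≤ y) (hy1 : y ≤ y₀ + ny * hy) :
    ∃ D ∈ discs, (x, y) ∈ D.carrierAt lam := by
  obtain ⟨k, hk, hk0, hk1⟩ :=
    mem_segments (x₀ := (lam0 : ℝ)) (h := (Δ : ℝ)) (x := lam) N hN hl0 hl1
  obtain ⟨i, hi, hxi0, hxi1⟩ :=
    mem_segments (x₀ := (x₀ : ℝ)) (h := (hx : ℝ)) (x := x) nx hnx hx0 hx1
  obtain ⟨j, hj, hyj0, hyj1⟩ :=
    mem_segments (x₀ := (y₀ : ℝ)) (h := (hy : ℝ)) (x := y) ny hny hy0 hy1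
  have hstep : coverStep (gridCells x₀ y₀ hx hy nx ny) discs (lam0 + (k : ℚ) * Δ) Δ = true := by
    simp only [coverAll, List.all_eq_true, List.mem_range] at hcert
    exact hcert k hk
  have hlam : |lam - ((lam0 + (k : ℚ) * Δ : ℚ) : ℝ)| ≤ Δ := by
    have hΔR : (0 : ℝ) ≤ Δ := by exact_mod_cast hΔ
    rw [abs_le]; push_cast; constructor <;> linarith
  refine coverStep_sound hstep hlam (mem_gridCells hi hj) (Cell.mem_carrier.2 ?_)
  refine ⟨?_, ?_, ?_, ?_⟩ <;> push_cast <;> linarith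

/-- **Box verdicts ⇒ region bound, uniformly in λ.**  If for every λ in the range `f λ ≤ q` on every
listed disc at λ, and the certificate passes, then `f λ ≤ q` on the rectangle for every such λ. -/
theorem bound_on_rect_moving {x₀ y₀ hx hy lam0 Δ : ℚ} {nx ny N : ℕ} {discs : List MDisc}
    {f : ℝ → ℝ → ℝ → ℝ} {q : ℝ}
    (hcert : coverAll (gridCells x₀ y₀ hx hy nx ny) discs lam0 Δ N = true)
    (hnx : 0 < nx) (hny : 0 < ny) (hN : 0 < N) (hΔ : 0 ≤ Δ)
    (hbox : ∀ D ∈ discs, ∀ lam x y : ℝ, (lam0 : ℝ) ≤ lam → lam ≤ lam0 + N * Δ →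
      (x, y) ∈ D.carrierAt lam → f lam x y ≤ q)
    {lam : ℝ} (hl0 : (lam0 : ℝ) ≤ lam) (hl1 : lam ≤ lam0 + N * Δ)
    {x y : ℝ} (hx0 : (x₀ : ℝ) ≤ x) (hx1 : x ≤ x₀ + nx * hx)
    (hy0 : (y₀ : ℝ) ≤ y) (hy1 : y ≤ y₀ + ny * hy) : f lam x y ≤ q := by
  obtain ⟨D, hD, hmem⟩ := rect_covered_moving hcert hnx hny hN hΔ hl0 hl1 hx0 hx1 hy0 hy1
  exact hbox D hD lam x y hl0 hl1 hmem

/- Toy certificate in the production geometry (NOTES §lists): four sheared boxes of radius `1/5`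
(`r_sh`) at spacing `24/83` on the row `y = −16313/10⁵`, motion bound `7/5 ≥ |centre|`, dilations
`λ ∈ [1, 1 + 2/100]` in two steps (shrink `7/500`), covering the strip piece
`[-1, -1 + 24/83] × [y − 1/25, y + 1/25]` with six cells. -/
set_option maxHeartbeats 1600000 in
example : coverAll (gridCells (-1) (-16313/100000 - 1/25) (4/83) (2/25) 6 1)
    [⟨-108/83, -16313/100000, 1/5, 7/5, true⟩, ⟨-84/83, -16313/100000, 1/5, 7/5, true⟩,
     ⟨-60/83, -16313/100000, 1/5, 7/5, true⟩, ⟨-36/83, -16313/100000, 1/5, 7/5, true⟩]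
    1 (1/100) 2 = true := by
  simp only [coverAll, coverStep, gridCells, cellInMDisc, discOK, vertInM, MDisc.scaleQ,
    MDisc.shrink, List.range, List.range.loop, List.flatMap_cons, List.flatMap_nil, List.map_cons,
    List.map_nil, List.cons_append, List.nil_append, List.all_cons, List.all_nil, List.any_cons,
    List.any_nil, Bool.and_true, Bool.or_false, Bool.and_eq_true, Bool.or_eq_true,
    decide_eq_true_eq, if_true]
  norm_num

end Summit.AnomalousDissipation.SoloBlind.MovingDiscCover
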